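import Mathlib
import Summits.Ventures.PercRepro.TriangleCapTopValues

/-!
# PercRepro — THE WITNESSES OF THE `Δ = r − 2` BAND AND OF THE THIRD LAYER ON THE CELL (p3, gen 50; part 218a)

Three more deletion families from `K_{a,n−a}` minus a star at `0`: a pair at a leaf plus a pair off the star
(`pairAtLeafPlusPair`, `Σ d²` at `closed − (4 (r − 3) + 4)`), two pairs off the star (`twoPairsOff`,
`closed − (4 (r − 3) + 6)`), and three pairs from the vertex `1` to three leaves of the `(r − 3)`-star
(`threePairsAtVertex`, the `K_{2,3}` through the star's centre, `closed − 6 (r − 4)`), with the uniform deletion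
arithmetic (`two_deletions_arith`, `three_deletions_arith`: the drops `2 ·` degree sum `− 2`) and the three degree
lemmas of `bipMinusStar` (a small-side vertex `1 ≤ i < a`, a leaf, a non-leaf right vertex).  Axioms: standard.
-/

namespace PercRepro

namespace TriangleCap

namespace C047

open Finset

/-- **A PAIR AT A LEAF PLUS A DISJOINT PAIR** on `Fin n`: the `(r − 2)`-star at `0` minus `{1, a}` (at the leaf `a`) minus
`{2, n − 1}` (off the star). -/
abbrev pairAtLeafPlusPair (n a r : ℕ) (h1 : 1 < n) (h2 : 2 < n) (ha : a < n) : SimpleGraph (Fin n) :=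
  delEdge (delEdge (bipMinusStar n a (r - 2)) ⟨1, h1⟩ ⟨a, ha⟩) ⟨2, h2⟩ ⟨n - 1, by omega⟩

/-- **TWO PAIRS OFF THE STAR** on `Fin n`: the `(r − 2)`-star at `0` minus `{1, n − 1}` minus `{2, n − 2}`. -/
abbrev twoPairsOff (n a r : ℕ) (h1 : 1 < n) (h2 : 2 < n) : SimpleGraph (Fin n) :=
  delEdge (delEdge (bipMinusStar n a (r - 2)) ⟨1, h1⟩ ⟨n - 1, by omega⟩) ⟨2, h2⟩ ⟨n - 2, by omega⟩

/-- **THREE PAIRS AT THE VERTEX `1` TO THREE LEAVES** on `Fin n`: the `(r − 3)`-star at `0` minus `{1, a}`, `{1, a + 1}`,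
`{1, a + 2}` (the `K_{2,3}` through the star's centre). -/
abbrev threePairsAtVertex (n a r : ℕ) (h1 : 1 < n) (ha : a < n) (ha1 : a + 1 < n) (ha2 : a + 2 < n) :
    SimpleGraph (Fin n) :=
  delEdge (delEdge (delEdge (bipMinusStar n a (r - 3)) ⟨1, h1⟩ ⟨a, ha⟩) ⟨1, h1⟩ ⟨a + 1, ha1⟩) ⟨1, h1⟩ ⟨a + 2, ha2⟩

/-- The arithmetic of two deletions: `S₀ + (r − 2)(n − 1 − (r − 2)) = E₀ n`, `E₂ + 2 = E₀`, `S₁ + D₁ = S₀ + 2`,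
`S₂ + D₂ = S₁ + 2` with `D₁ + D₂ = 4 n − 6 + 2 c` (`D_i = 2 ·` the degree sum of the deleted pair) give
`S₂ + r (n − 1 − r) + (4 (r − 3) + 2 c) = E₂ n`. -/
theorem two_deletions_arith (n r E₀ E₂ S₀ S₁ S₂ D₁ D₂ c : ℕ) (hr : 3 ≤ r) (hn : r + 1 ≤ n)
    (hS0 : S₀ + (r - 2) * (n - 1 - (r - 2)) = E₀ * n) (hE : E₂ + 2 = E₀)
    (hS1 : S₁ + D₁ = S₀ + 2) (hS2 : S₂ + D₂ = S₁ + 2) (hD : D₁ + D₂ = 4 * n - 6 + 2 * c) :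
    S₂ + r * (n - 1 - r) + (4 * (r - 3) + 2 * c) = E₂ * n := by
  obtain ⟨r', rfl⟩ : ∃ r', r = r' + 3 := ⟨r - 3, by omega⟩
  obtain ⟨t, rfl⟩ : ∃ t, n = r' + 4 + t := ⟨n - (r' + 4), by omega⟩
  subst hE
  have e1 : r' + 3 - 2 = r' + 1 := by omega
  have e2 : r' + 4 + t - 1 - (r' + 1) = t + 2 := by omega
  have e3 : r' + 4 + t - 1 - (r' + 3) = t := by omega
  have e4 : r' + 3 - 3 = r' := by omega
  have e5 : 4 * (r' + 4 + t) - 6 = 4 * r' + 10 + 4 * t := by omega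
  rw [e1, e2] at hS0
  rw [e5] at hD
  rw [e3, e4]
  zify at hS0 hS1 hS2 hD ⊢
  linear_combination hS0 + hS1 + hS2 - hD

/-- The arithmetic of three deletions from the `(r − 3)`-star: `S₀ + (r − 3)(n − 1 − (r − 3)) = E₀ n`, `E₃ + 3 = E₀`,
the three degree sums `D₁ + D₂ + D₃ = 6 n − 12` give `S₃ + r (n − 1 − r) + 6 (r − 4) = E₃ n`. -/
theorem three_deletions_arith (n r E₀ E₃ S₀ S₁ S₂ S₃ D₁ D₂ D₃ : ℕ) (hr : 4 ≤ r) (hn : r + 1 ≤ n)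
    (hS0 : S₀ + (r - 3) * (n - 1 - (r - 3)) = E₀ * n) (hE : E₃ + 3 = E₀)
    (hS1 : S₁ + D₁ = S₀ + 2) (hS2 : S₂ + D₂ = S₁ + 2) (hS3 : S₃ + D₃ = S₂ + 2) (hD : D₁ + D₂ + D₃ = 6 * n - 12) :
    S₃ + r * (n - 1 - r) + 6 * (r - 4) = E₃ * n := by
  obtain ⟨r', rfl⟩ : ∃ r', r = r' + 4 := ⟨r - 4, by omega⟩
  obtain ⟨t, rfl⟩ : ∃ t, n = r' + 5 + t := ⟨n - (r' + 5), by omega⟩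
  subst hE
  have e1 : r' + 4 - 3 = r' + 1 := by omega
  have e2 : r' + 5 + t - 1 - (r' + 1) = t + 3 := by omega
  have e3 : r' + 5 + t - 1 - (r' + 4) = t := by omega
  have e4 : r' + 4 - 4 = r' := by omega
  have e5 : 6 * (r' + 5 + t) - 12 = 6 * r' + 18 + 6 * t := by omega
  rw [e1, e2] at hS0
  rw [e5] at hD
  rw [e3, e4]
  zify at hS0 hS1 hS2 hS3 hD ⊢
  linear_combination hS0 + hS1 + hS2 + hS3 - hD

/-- The degree of a vertex `⟨i, _⟩` with `1 ≤ i < a` in `bipMinusStar n a q` is `n − a`. -/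
theorem deg_bipMinusStar_small_left (n a q i : ℕ) (hi1 : 1 ≤ i) (hia : i < a) (han : a + q ≤ n) (hi : i < n) :
    deg (bipMinusStar n a q) ⟨i, hi⟩ = n - a := by
  rw [deg_bipMinusStar n a q (by omega) han]
  rw [if_neg (by simp only; omega), if_neg (by
    unfold rightStar
    simp only [mem_filter, mem_univ, true_and]
    omega)]
  exact deg_bip_of_lt n a (by omega) _ (by simp only; omega)

/-- The degree of a leaf `⟨i, _⟩` (`a ≤ i < a + q`) of the star in `bipMinusStar n a q` is `a − 1`. -/
theorem deg_bipMinusStar_leaf (n a q i : ℕ) (ha : 1 ≤ a) (hia : a ≤ i) (hiq : i < a + q) (han : a + q ≤ n)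
    (hi : i < n) : deg (bipMinusStar n a q) ⟨i, hi⟩ = a - 1 := by
  rw [deg_bipMinusStar n a q ha han]
  rw [if_neg (by simp only; omega), if_pos (by
    unfold rightStar
    simp only [mem_filter, mem_univ, true_and]
    omega)]

/-- The degree of a non-leaf right vertex `⟨i, _⟩` (`a + q ≤ i`) in `bipMinusStar n a q` is `a`. -/
theorem deg_bipMinusStar_right (n a q i : ℕ) (ha : 1 ≤ a) (hiq : a + q ≤ i) (han : a + q ≤ n) (hi : i < n) :
    deg (bipMinusStar n a q) ⟨i, hi⟩ = a := by
  rw [deg_bipMinusStar n a q ha han]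
  rw [if_neg (by simp only; omega), if_neg (by
    unfold rightStar
    simp only [mem_filter, mem_univ, true_and]
    omega)]
  exact deg_bip_of_not_lt n a (by omega) _ (by simp only; omega)

/-- A cross pair `⟨i, _⟩ ⟨j, _⟩` (`i < a ≤ j`) not at `0` is an edge of `bipMinusStar n a q`. -/
theorem bipMinusStar_adj_cross (n a q i j : ℕ) (hi1 : 1 ≤ i) (hia : i < a) (hja : a ≤ j) (hi : i < n) (hj : j < n) :
    (bipMinusStar n a q).Adj ⟨i, hi⟩ ⟨j, hj⟩ := by
  rw [bipMinusStar_adj]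
  simp only
  exact ⟨Or.inl ⟨by omega, by omega⟩, by omega⟩

/-- **THE WITNESS FOR `4 (r − 3) + 4`:** for `3 ≤ a`, `4 ≤ r`, `a + r ≤ n + 1`, `r + 1 ≤ n`. -/
theorem pairAtLeafPlusPair_value (n a r : ℕ) (ha3 : 3 ≤ a) (hr4 : 4 ≤ r) (han : a + r ≤ n + 1) (hn : r + 1 ≤ n) :
    K4mFree (pairAtLeafPlusPair n a r (by omega) (by omega) (by omega)) ∧
      (pairAtLeafPlusPair n a r (by omega) (by omega) (by omega)).edgeFinset.card + r = a * (n - a) ∧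
      ∑ v, deg (pairAtLeafPlusPair n a r (by omega) (by omega) (by omega)) v *
          deg (pairAtLeafPlusPair n a r (by omega) (by omega) (by omega)) v + r * (n - 1 - r) +
          (4 * (r - 3) + 2 * 2) =
        (pairAtLeafPlusPair n a r (by omega) (by omega) (by omega)).edgeFinset.card * n := by
  have h1 : 1 < n := by omega
  have h2 : 2 < n := by omega
  have ha : a < n := by omega
  have hn1 : n - 1 < n := by omega
  have hadj1 := bipMinusStar_adj_cross n a (r - 2) 1 a (by omega) (by omega) (le_refl a) h1 ha
  have hadj2 := bipMinusStar_adj_cross n a (r - 2) 2 (n - 1) (by omega) (by omega) (by omega) h2 hn1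
  have hadj2' : (delEdge (bipMinusStar n a (r - 2)) ⟨1, h1⟩ ⟨a, ha⟩).Adj ⟨2, h2⟩ ⟨n - 1, hn1⟩ := by
    rw [delEdge_adj]
    refine ⟨hadj2, ?_⟩
    simp only [Fin.mk.injEq]
    omega
  have hd1 := deg_bipMinusStar_small_left n a (r - 2) 1 (le_refl 1) (by omega) (by omega) h1
  have hda := deg_bipMinusStar_leaf n a (r - 2) a (by omega) (le_refl a) (by omega) (by omega) ha
  have hd2 := deg_bipMinusStar_small_left n a (r - 2) 2 (by omega) (by omega) (by omega) h2
  have hdn := deg_bipMinusStar_right n a (r - 2) (n - 1) (by omega) (by omega) (by omega) hn1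
  have hd2' : deg (delEdge (bipMinusStar n a (r - 2)) ⟨1, h1⟩ ⟨a, ha⟩) ⟨2, h2⟩ = n - a := by
    have := deg_delEdge (bipMinusStar n a (r - 2)) hadj1 ⟨2, h2⟩
    rw [if_neg (by simp only [Fin.mk.injEq]; omega)] at this
    omega
  have hdn' : deg (delEdge (bipMinusStar n a (r - 2)) ⟨1, h1⟩ ⟨a, ha⟩) ⟨n - 1, hn1⟩ = a := by
    have := deg_delEdge (bipMinusStar n a (r - 2)) hadj1 ⟨n - 1, hn1⟩
    rw [if_neg (by simp only [Fin.mk.injEq]; omega)] at this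
    omega
  have hS0 := sum_deg_sq_bipMinusStar n a (r - 2) (by omega) (by omega) (by omega)
  rw [Fintype.card_fin] at hS0
  have hE0 := card_edges_bipMinusStar n a (r - 2) (by omega) (by omega)
  have hE1 := card_edges_delEdge (bipMinusStar n a (r - 2)) hadj1
  have hE2 := card_edges_delEdge (delEdge (bipMinusStar n a (r - 2)) ⟨1, h1⟩ ⟨a, ha⟩) hadj2'
  have hS1 := sum_deg_sq_delEdge (bipMinusStar n a (r - 2)) hadj1
  rw [hd1, hda] at hS1
  have hS2 := sum_deg_sq_delEdge (delEdge (bipMinusStar n a (r - 2)) ⟨1, h1⟩ ⟨a, ha⟩) hadj2'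
  rw [hd2', hdn'] at hS2
  refine ⟨?_, ?_, ?_⟩
  · exact k4mFree_of_le _ _ (delEdge_le _ _ _)
      (k4mFree_of_le _ _ (delEdge_le _ _ _) (k4mFree_bipMinusStar n a (r - 2)))
  · show (delEdge (delEdge (bipMinusStar n a (r - 2)) ⟨1, h1⟩ ⟨a, ha⟩) ⟨2, h2⟩ ⟨n - 1, hn1⟩).edgeFinset.card + r =
      a * (n - a)
    omega
  · show ∑ v, deg (delEdge (delEdge (bipMinusStar n a (r - 2)) ⟨1, h1⟩ ⟨a, ha⟩) ⟨2, h2⟩ ⟨n - 1, hn1⟩) v *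
        deg (delEdge (delEdge (bipMinusStar n a (r - 2)) ⟨1, h1⟩ ⟨a, ha⟩) ⟨2, h2⟩ ⟨n - 1, hn1⟩) v +
        r * (n - 1 - r) + (4 * (r - 3) + 2 * 2) =
      (delEdge (delEdge (bipMinusStar n a (r - 2)) ⟨1, h1⟩ ⟨a, ha⟩) ⟨2, h2⟩ ⟨n - 1, hn1⟩).edgeFinset.card * n
    exact two_deletions_arith n r _ _ _ _ _ _ _ 2 (by omega) hn hS0 (by omega) hS1 hS2 (by omega)

/-- **THE WITNESS FOR `4 (r − 3) + 6`:** for `3 ≤ a`, `4 ≤ r`, `a + r ≤ n`, `r + 1 ≤ n`. -/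
theorem twoPairsOff_value (n a r : ℕ) (ha3 : 3 ≤ a) (hr4 : 4 ≤ r) (han : a + r ≤ n) (hn : r + 1 ≤ n) :
    K4mFree (twoPairsOff n a r (by omega) (by omega)) ∧
      (twoPairsOff n a r (by omega) (by omega)).edgeFinset.card + r = a * (n - a) ∧
      ∑ v, deg (twoPairsOff n a r (by omega) (by omega)) v * deg (twoPairsOff n a r (by omega) (by omega)) v +
          r * (n - 1 - r) + (4 * (r - 3) + 2 * 3) =
        (twoPairsOff n a r (by omega) (by omega)).edgeFinset.card * n := by
  have h1 : 1 < n := by omega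
  have h2 : 2 < n := by omega
  have hn1 : n - 1 < n := by omega
  have hn2 : n - 2 < n := by omega
  have hadj1 := bipMinusStar_adj_cross n a (r - 2) 1 (n - 1) (by omega) (by omega) (by omega) h1 hn1
  have hadj2 := bipMinusStar_adj_cross n a (r - 2) 2 (n - 2) (by omega) (by omega) (by omega) h2 hn2
  have hadj2' : (delEdge (bipMinusStar n a (r - 2)) ⟨1, h1⟩ ⟨n - 1, hn1⟩).Adj ⟨2, h2⟩ ⟨n - 2, hn2⟩ := by
    rw [delEdge_adj]
    refine ⟨hadj2, ?_⟩
    simp only [Fin.mk.injEq]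
    omega
  have hd1 := deg_bipMinusStar_small_left n a (r - 2) 1 (le_refl 1) (by omega) (by omega) h1
  have hdn := deg_bipMinusStar_right n a (r - 2) (n - 1) (by omega) (by omega) (by omega) hn1
  have hd2 := deg_bipMinusStar_small_left n a (r - 2) 2 (by omega) (by omega) (by omega) h2
  have hdn2 := deg_bipMinusStar_right n a (r - 2) (n - 2) (by omega) (by omega) (by omega) hn2
  have hd2' : deg (delEdge (bipMinusStar n a (r - 2)) ⟨1, h1⟩ ⟨n - 1, hn1⟩) ⟨2, h2⟩ = n - a := by
    have := deg_delEdge (bipMinusStar n a (r - 2)) hadj1 ⟨2, h2⟩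
    rw [if_neg (by simp only [Fin.mk.injEq]; omega)] at this
    omega
  have hdn2' : deg (delEdge (bipMinusStar n a (r - 2)) ⟨1, h1⟩ ⟨n - 1, hn1⟩) ⟨n - 2, hn2⟩ = a := by
    have := deg_delEdge (bipMinusStar n a (r - 2)) hadj1 ⟨n - 2, hn2⟩
    rw [if_neg (by simp only [Fin.mk.injEq]; omega)] at this
    omega
  have hS0 := sum_deg_sq_bipMinusStar n a (r - 2) (by omega) (by omega) (by omega)
  rw [Fintype.card_fin] at hS0
  have hE0 := card_edges_bipMinusStar n a (r - 2) (by omega) (by omega)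
  have hE1 := card_edges_delEdge (bipMinusStar n a (r - 2)) hadj1
  have hE2 := card_edges_delEdge (delEdge (bipMinusStar n a (r - 2)) ⟨1, h1⟩ ⟨n - 1, hn1⟩) hadj2'
  have hS1 := sum_deg_sq_delEdge (bipMinusStar n a (r - 2)) hadj1
  rw [hd1, hdn] at hS1
  have hS2 := sum_deg_sq_delEdge (delEdge (bipMinusStar n a (r - 2)) ⟨1, h1⟩ ⟨n - 1, hn1⟩) hadj2'
  rw [hd2', hdn2'] at hS2
  refine ⟨?_, ?_, ?_⟩
  · exact k4mFree_of_le _ _ (delEdge_le _ _ _)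
      (k4mFree_of_le _ _ (delEdge_le _ _ _) (k4mFree_bipMinusStar n a (r - 2)))
  · show (delEdge (delEdge (bipMinusStar n a (r - 2)) ⟨1, h1⟩ ⟨n - 1, hn1⟩) ⟨2, h2⟩
      ⟨n - 2, hn2⟩).edgeFinset.card + r = a * (n - a)
    omega
  · show ∑ v, deg (delEdge (delEdge (bipMinusStar n a (r - 2)) ⟨1, h1⟩ ⟨n - 1, hn1⟩) ⟨2, h2⟩ ⟨n - 2, hn2⟩) v *
        deg (delEdge (delEdge (bipMinusStar n a (r - 2)) ⟨1, h1⟩ ⟨n - 1, hn1⟩) ⟨2, h2⟩ ⟨n - 2, hn2⟩) v +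
        r * (n - 1 - r) + (4 * (r - 3) + 2 * 3) =
      (delEdge (delEdge (bipMinusStar n a (r - 2)) ⟨1, h1⟩ ⟨n - 1, hn1⟩) ⟨2, h2⟩ ⟨n - 2, hn2⟩).edgeFinset.card * n
    exact two_deletions_arith n r _ _ _ _ _ _ _ 3 (by omega) hn hS0 (by omega) hS1 hS2 (by omega)

/-- **THE WITNESS FOR `6 (r − 4)`:** for `2 ≤ a`, `6 ≤ r`, `a + r ≤ n + 2`, `r + 1 ≤ n`. -/
theorem threePairsAtVertex_value (n a r : ℕ) (ha2 : 2 ≤ a) (hr6 : 6 ≤ r) (han : a + r ≤ n + 2) (hn : r + 1 ≤ n) :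
    K4mFree (threePairsAtVertex n a r (by omega) (by omega) (by omega) (by omega)) ∧
      (threePairsAtVertex n a r (by omega) (by omega) (by omega) (by omega)).edgeFinset.card + r = a * (n - a) ∧
      ∑ v, deg (threePairsAtVertex n a r (by omega) (by omega) (by omega) (by omega)) v *
          deg (threePairsAtVertex n a r (by omega) (by omega) (by omega) (by omega)) v + r * (n - 1 - r) +
          6 * (r - 4) =
        (threePairsAtVertex n a r (by omega) (by omega) (by omega) (by omega)).edgeFinset.card * n := by
  have h1 : 1 < n := by omega
  have ha : a < n := by omega
  have ha1 : a + 1 < n := by omega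
  have ha2' : a + 2 < n := by omega
  have hadj1 := bipMinusStar_adj_cross n a (r - 3) 1 a (le_refl 1) (by omega) (le_refl a) h1 ha
  have hadj2 := bipMinusStar_adj_cross n a (r - 3) 1 (a + 1) (le_refl 1) (by omega) (by omega) h1 ha1
  have hadj3 := bipMinusStar_adj_cross n a (r - 3) 1 (a + 2) (le_refl 1) (by omega) (by omega) h1 ha2'
  have hadj2' : (delEdge (bipMinusStar n a (r - 3)) ⟨1, h1⟩ ⟨a, ha⟩).Adj ⟨1, h1⟩ ⟨a + 1, ha1⟩ := by
    rw [delEdge_adj]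
    refine ⟨hadj2, ?_⟩
    simp only [Fin.mk.injEq]
    omega
  have hadj3' : (delEdge (delEdge (bipMinusStar n a (r - 3)) ⟨1, h1⟩ ⟨a, ha⟩) ⟨1, h1⟩ ⟨a + 1, ha1⟩).Adj ⟨1, h1⟩
      ⟨a + 2, ha2'⟩ := by
    rw [delEdge_adj]
    refine ⟨?_, ?_⟩
    · rw [delEdge_adj]
      refine ⟨hadj3, ?_⟩
      simp only [Fin.mk.injEq]
      omega
    · simp only [Fin.mk.injEq]
      omega
  have hd1 := deg_bipMinusStar_small_left n a (r - 3) 1 (le_refl 1) (by omega) (by omega) h1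
  have hda := deg_bipMinusStar_leaf n a (r - 3) a (by omega) (le_refl a) (by omega) (by omega) ha
  have hda1 := deg_bipMinusStar_leaf n a (r - 3) (a + 1) (by omega) (by omega) (by omega) (by omega) ha1
  have hda2 := deg_bipMinusStar_leaf n a (r - 3) (a + 2) (by omega) (by omega) (by omega) (by omega) ha2'
  -- after the first deletion
  have hd1' : deg (delEdge (bipMinusStar n a (r - 3)) ⟨1, h1⟩ ⟨a, ha⟩) ⟨1, h1⟩ = n - a - 1 := by
    have := deg_delEdge (bipMinusStar n a (r - 3)) hadj1 ⟨1, h1⟩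
    rw [if_pos (Or.inl rfl)] at this
    omega
  have hda1' : deg (delEdge (bipMinusStar n a (r - 3)) ⟨1, h1⟩ ⟨a, ha⟩) ⟨a + 1, ha1⟩ = a - 1 := by
    have := deg_delEdge (bipMinusStar n a (r - 3)) hadj1 ⟨a + 1, ha1⟩
    rw [if_neg (by simp only [Fin.mk.injEq]; omega)] at this
    omega
  have hda2' : deg (delEdge (bipMinusStar n a (r - 3)) ⟨1, h1⟩ ⟨a, ha⟩) ⟨a + 2, ha2'⟩ = a - 1 := by
    have := deg_delEdge (bipMinusStar n a (r - 3)) hadj1 ⟨a + 2, ha2'⟩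
    rw [if_neg (by simp only [Fin.mk.injEq]; omega)] at this
    omega
  -- after the second deletion
  have hd1'' : deg (delEdge (delEdge (bipMinusStar n a (r - 3)) ⟨1, h1⟩ ⟨a, ha⟩) ⟨1, h1⟩ ⟨a + 1, ha1⟩) ⟨1, h1⟩ =
      n - a - 2 := by
    have := deg_delEdge (delEdge (bipMinusStar n a (r - 3)) ⟨1, h1⟩ ⟨a, ha⟩) hadj2' ⟨1, h1⟩
    rw [if_pos (Or.inl rfl)] at this
    omega
  have hda2'' : deg (delEdge (delEdge (bipMinusStar n a (r - 3)) ⟨1, h1⟩ ⟨a, ha⟩) ⟨1, h1⟩ ⟨a + 1, ha1⟩)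
      ⟨a + 2, ha2'⟩ = a - 1 := by
    have := deg_delEdge (delEdge (bipMinusStar n a (r - 3)) ⟨1, h1⟩ ⟨a, ha⟩) hadj2' ⟨a + 2, ha2'⟩
    rw [if_neg (by simp only [Fin.mk.injEq]; omega)] at this
    omega
  have hS0 := sum_deg_sq_bipMinusStar n a (r - 3) (by omega) (by omega) (by omega)
  rw [Fintype.card_fin] at hS0
  have hE0 := card_edges_bipMinusStar n a (r - 3) (by omega) (by omega)
  have hE1 := card_edges_delEdge (bipMinusStar n a (r - 3)) hadj1
  have hE2 := card_edges_delEdge (delEdge (bipMinusStar n a (r - 3)) ⟨1, h1⟩ ⟨a, ha⟩) hadj2'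
  have hE3 := card_edges_delEdge (delEdge (delEdge (bipMinusStar n a (r - 3)) ⟨1, h1⟩ ⟨a, ha⟩) ⟨1, h1⟩
    ⟨a + 1, ha1⟩) hadj3'
  have hS1 := sum_deg_sq_delEdge (bipMinusStar n a (r - 3)) hadj1
  rw [hd1, hda] at hS1
  have hS2 := sum_deg_sq_delEdge (delEdge (bipMinusStar n a (r - 3)) ⟨1, h1⟩ ⟨a, ha⟩) hadj2'
  rw [hd1', hda1'] at hS2
  have hS3 := sum_deg_sq_delEdge (delEdge (delEdge (bipMinusStar n a (r - 3)) ⟨1, h1⟩ ⟨a, ha⟩) ⟨1, h1⟩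
    ⟨a + 1, ha1⟩) hadj3'
  rw [hd1'', hda2''] at hS3
  refine ⟨?_, ?_, ?_⟩
  · exact k4mFree_of_le _ _ (delEdge_le _ _ _) (k4mFree_of_le _ _ (delEdge_le _ _ _)
      (k4mFree_of_le _ _ (delEdge_le _ _ _) (k4mFree_bipMinusStar n a (r - 3))))
  · show (delEdge (delEdge (delEdge (bipMinusStar n a (r - 3)) ⟨1, h1⟩ ⟨a, ha⟩) ⟨1, h1⟩ ⟨a + 1, ha1⟩) ⟨1, h1⟩
      ⟨a + 2, ha2'⟩).edgeFinset.card + r = a * (n - a)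
    omega
  · show ∑ v, deg (delEdge (delEdge (delEdge (bipMinusStar n a (r - 3)) ⟨1, h1⟩ ⟨a, ha⟩) ⟨1, h1⟩ ⟨a + 1, ha1⟩)
        ⟨1, h1⟩ ⟨a + 2, ha2'⟩) v *
        deg (delEdge (delEdge (delEdge (bipMinusStar n a (r - 3)) ⟨1, h1⟩ ⟨a, ha⟩) ⟨1, h1⟩ ⟨a + 1, ha1⟩)
        ⟨1, h1⟩ ⟨a + 2, ha2'⟩) v + r * (n - 1 - r) + 6 * (r - 4) =
      (delEdge (delEdge (delEdge (bipMinusStar n a (r - 3)) ⟨1, h1⟩ ⟨a, ha⟩) ⟨1, h1⟩ ⟨a + 1, ha1⟩) ⟨1, h1⟩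
        ⟨a + 2, ha2'⟩).edgeFinset.card * n
    exact three_deletions_arith n r _ _ _ _ _ _ _ _ _ (by omega) hn hS0 (by omega) hS1 hS2 hS3 (by omega)

end C047

end TriangleCap

end PercRepro
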